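import Literature.AlgebraicGeometry.HodgeTheory.ConjugationChartUniqueness
import Literature.AlgebraicGeometry.HodgeTheory.JouanolouDeviceHolds
import Literature.AlgebraicGeometry.HodgeTheory.AffineVarietyCoordinates
import Literature.AlgebraicGeometry.HodgeTheory.ZariskiLocallyAffineProductBaseChange
import HarnessLib

/-!
# `chartConjugation_canonical` from an affine conjugation datum (clause (ii) via Jouanolou's device)

Family `hodge`, layer `Literature/AlgebraicGeometry/HodgeTheory` (theorems + one auxiliary structure;
no named fact; net debt 0). Lane `lit-hodgefound`, row Q19 = staging S3a of the V-B2′ programme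
(`chartConjugation_canonical`, file `ConjugationChartUniqueness`: conjugation of cohomology is canonical,
σ-semilinear, natural for morphisms into smooth projective varieties, and computed by charts on smooth
affine ones — Charles–Schnell, *Notes on absolute Hodge classes*, §11.2.2 (11.2.2)–(11.2.3) with
Grothendieck's comparison theorem).

**What is proved.** The fact quantifies its conjugation maps `θ_X` over ALL `ℂ`-schemes and asks
naturality (clause (ii)) for morphisms `g : Y ⟶ X` into smooth PROJECTIVE `X`. This file reduces it to
a purely AFFINE datum: maps `θ_Y : Hᵏ(Y(ℂ); ℂ) → Hᵏ(Y^σ(ℂ); ℂ)` which are (a) `σ`-semilinear,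
(b) natural for `ℂ`-morphisms BETWEEN SMOOTH AFFINE `ℂ`-schemes, and (c) computed by charts exactly as
in clause (iii) of the fact. Given such a datum (for each `σ`, `k`), `chartConjugation_canonical` holds
(`chartConjugation_canonical_of_affine`). The remaining content of the fact is thereby isolated on
smooth affine varieties, where it is Grothendieck's algebraic de Rham theorem (both halves,
Grothendieck 1966 Thm. 1′) together with the rigidity of natural rationally-normalised de Rham
families (Conner–Floyd (15.3)); nothing projective or global remains.

**How.** For `X` smooth projective choose Jouanolou's affine torsor `π₀ : Y₀ ⟶ X`
(`Motives/JouanolouTorsor`, `HodgeTheory/JouanolouDeviceHolds`: `Y₀` smooth affine, `π₀` Zariski-locally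
`V × 𝔸ᴺ → V`, so `(π₀^σ)^*` is bijective on `Hᵏ(–(ℂ); ℂ)`,
`bijective_complexBetti_map_of_isZariskiLocallyAffineProduct`) and TRANSPORT: `Θ_X := ((π₀^σ)^*)⁻¹ ∘
θ_{Y₀} ∘ π₀^*` (`extendConj`; `Θ_X := θ_X` when `X` is not smooth projective). Naturality of `Θ` for
`h : Y' ⟶ X` from a smooth affine `Y'` (`theta_map_eq_of_affine`, the key lemma) goes through the fibre
product `W := Y' ×_X Y₀`: it is smooth affine, its projection `p : W ⟶ Y'` is again an affine-space
bundle (`IsZariskiLocallyAffineProduct.fibreProd_fst`, file `ZariskiLocallyAffineProductBaseChange`),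
hence `(p^σ)^*` is injective (`Y'^σ(ℂ)` is paracompact Hausdorff: a closed subspace of some `ℂᴹ`), and
`(p^σ)^* θ_{Y'} h^* = θ_W p^* h^* = θ_W q^* π₀^* = (q^σ)^* θ_{Y₀} π₀^* = (q^σ)^* (π₀^σ)^* Θ_X =
(p^σ)^* (h^σ)^* Θ_X` by affine naturality (b) for `p` and `q : W ⟶ Y₀`. Clause (ii) for projective
sources `Y` follows by applying this to `Y`'s own torsor, clause (iii) because `Θ_Y = θ_Y` on smooth
affine `Y` (the key lemma with `h = 𝟙`), clause (i) by transport of (a).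

Not here: any construction of an affine datum (that is the content of V-B2′: (G) + (G-inj) + rigidity).

## References

* F. Charles, C. Schnell, *Notes on absolute Hodge classes*, in *Hodge Theory*, Math. Notes 49 (2014),
  §11.2.2 (11.2.1)–(11.2.3), Thm. 11.1.2 and the Remark following it (print pp. 471–472, 479).
  [CharlesSchnell2014Notes]
* J.-P. Jouanolou, *Une suite exacte de Mayer–Vietoris en K-théorie algébrique*, LNM 341 (1973),
  Lemme 1.5. [Jouanolou1973]
* A. Grothendieck, *On the de Rham cohomology of algebraic varieties*, Publ. IHÉS 29 (1966), Thm. 1′.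
  [Grothendieck1966]
* R. Hartshorne, *Algebraic Geometry* (1977), II.3 Thm. 3.3, III Prop. 10.1. [Hartshorne1977]
-/

noncomputable section

open CategoryTheory CategoryTheory.Limits AlgebraicGeometry MonoidalCategory
open scoped Manifold ContDiff
open Literature.NumberTheory.Transcendental Literature.Geometry.Kaehler
open Literature.AlgebraicTopology.SingularHomology
open Literature.AlgebraicGeometry.Motives

namespace Literature.AlgebraicGeometry.HodgeTheory

section HodgeTheory

/-! ### §1 Point-set and scheme-theoretic preliminaries on smooth affine `ℂ`-schemes -/

section Prelim

/-- `V(ℂ)` is paracompact for `V` affine of finite type over `ℂ`: it is a closed subspace of some `ℂᴹ`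
(`AffineCoordinates.isClosedEmbedding_coordMap`), hence locally compact, σ-compact and Hausdorff.
[cite: SerreGAGA1956, §2 n°5 Lemme 1] -/
theorem paracompactSpace_complexPoints_of_isAffine (V : SchemeOver ℂ) [IsAffine V.left]
    [LocallyOfFiniteType V.hom] : ParacompactSpace (ComplexPoints V) := by
  obtain ⟨M, h, hh⟩ := AffineCoordinates.exists_isClosedImmersion_homOfVector V
  have hce := AffineCoordinates.isClosedEmbedding_coordMap V h hh
  haveI := hce.locallyCompactSpace
  haveI := hce.sigmaCompactSpace
  haveI : T2Space (ComplexPoints V) := AffineCoordinates.t2Space V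
  infer_instance

/-- `V(ℂ)` is paracompact Hausdorff for `V` smooth affine over `ℂ` (smooth ⇒ locally of finite type).
[cite: SerreGAGA1956, §2 n°5 Lemme 1] -/
theorem paracompactSpace_complexPoints_of_smooth_affine (m : ℕ) (V : SchemeOver ℂ) [IsAffine V.left]
    [SmoothOfRelativeDimension m V.hom] : ParacompactSpace (ComplexPoints V) := by
  haveI : Smooth V.hom := SmoothOfRelativeDimension.smooth m V.hom
  exact paracompactSpace_complexPoints_of_isAffine V

/-- A `ℂ`-morphism from an AFFINE `ℂ`-scheme to a `ℂ`-scheme SEPARATED over `ℂ` is an affine morphism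
(cancellation for the class of affine morphisms — closed immersions are affine, stable under
composition and base change — against the separated `X → Spec ℂ`; Mathlib `IsAffineHom.of_comp`
applied to `π ≫ (X → Spec ℂ) = (Y₀ → Spec ℂ)`, which is affine).
[cite: Hartshorne1977, II Ex. 4.8 (e) with II Ex. 5.17 (b)] -/
theorem isAffineHom_left_of_isAffine_of_isSeparated {Y₀ X : SchemeOver ℂ} (π : Y₀ ⟶ X)
    [IsAffine Y₀.left] [IsSeparated X.hom] : IsAffineHom π.left := by
  haveI : IsAffineHom (π.left ≫ X.hom) := by rw [Over.w π]; infer_instance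
  exact IsAffineHom.of_comp π.left X.hom

/-- Conjugation of `ℂ`-morphisms is functorial: `(f ≫ g)^σ = f^σ ≫ g^σ` (base change is a functor).
[cite: CharlesSchnell2014Notes, §11.2.2 (11.2.1)] -/
theorem conjHom_comp (σ : ℂ ≃+* ℂ) {Z Y X : SchemeOver ℂ} (f : Z ⟶ Y) (g : Y ⟶ X) :
    conjHom σ (f ≫ g) = conjHom σ f ≫ conjHom σ g :=
  CategoryTheory.Functor.map_comp _ _ _

/-- Conjugation of `ℂ`-morphisms is functorial: `(𝟙 Y)^σ = 𝟙 (Y^σ)`. [cite: CharlesSchnell2014Notes, §11.2.2 (11.2.1)] -/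
theorem conjHom_id (σ : ℂ ≃+* ℂ) (Y : SchemeOver ℂ) : conjHom σ (𝟙 Y) = 𝟙 (conjugateVariety σ Y) :=
  CategoryTheory.Functor.map_id _ _

end Prelim

/-! ### §2 Jouanolou charts of smooth projective varieties, with the smoothness of the projection -/

section Chart

variable (σ : ℂ ≃+* ℂ) (k : ℕ)

/-- **Jouanolou chart** of a `ℂ`-scheme `X` (auxiliary structure): a smooth AFFINE `Y₀` over `ℂ` and an
AFFINE `ℂ`-morphism `π₀ : Y₀ ⟶ X`, SMOOTH of relative dimension `r`, which is Zariski-locally on `X` the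
projection `V × 𝔸ʳ → V`, and whose conjugate `π₀^σ` is bijective on `Hᵏ(–(ℂ); ℂ)`. Every smooth
projective `X` has one (`jouanolouChart`). [cite: Jouanolou1973, Lemme 1.5] -/
structure JouanolouChart (X : SchemeOver ℂ) : Type 1 where
  /-- Rank of the affine-space bundle. [cite: Jouanolou1973, Lemme 1.5] -/
  r : ℕ
  /-- Dimension of the total space. [cite: Jouanolou1973, Lemme 1.5] -/
  m₀ : ℕ
  /-- The smooth affine total space `Y₀`. [cite: Jouanolou1973, Lemme 1.5] -/
  Y₀ : SchemeOver ℂ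
  /-- `Y₀` is affine. [cite: Jouanolou1973, Lemme 1.5] -/
  [isAffine : IsAffine Y₀.left]
  /-- `Y₀` is smooth over `ℂ` of relative dimension `m₀`. [cite: Jouanolou1973, Lemme 1.5] -/
  [smooth : SmoothOfRelativeDimension m₀ Y₀.hom]
  /-- The projection `π₀ : Y₀ ⟶ X`. [cite: Jouanolou1973, Lemme 1.5] -/
  π₀ : Y₀ ⟶ X
  /-- `π₀` is smooth of relative dimension `r`. [cite: Hartshorne1977, III Prop. 10.1] -/
  [smooth_π₀ : SmoothOfRelativeDimension r π₀.left]
  /-- `π₀` is an affine morphism. [cite: Hartshorne1977, II Ex. 5.17] -/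
  [isAffineHom_π₀ : IsAffineHom π₀.left]
  /-- `π₀` is Zariski-locally on `X` the projection `V × 𝔸ʳ → V`. [cite: Jouanolou1973, Lemme 1.5] -/
  isZariskiLocallyAffineProduct : IsZariskiLocallyAffineProduct π₀ r
  /-- `(π₀^σ)^*` is bijective on `Hᵏ(–(ℂ); ℂ)`. [cite: Jouanolou1973, Lemme 1.5] -/
  bijective : Function.Bijective (complexBetti.map (conjHom σ π₀) k)

attribute [instance] JouanolouChart.isAffine JouanolouChart.smooth JouanolouChart.smooth_π₀
  JouanolouChart.isAffineHom_π₀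

variable {σ k}

/-- **Smooth projective varieties have Jouanolou charts**: Jouanolou's torsor `Y₀ ⊆ X × (ℙᴺ)^*` of a
closed immersion `X ↪ ℙᴺ` (`Motives/JouanolouTorsor`; affine and smooth, `JouanolouDeviceHolds`), its
projection `π₀ = (open immersion) ≫ pr₁` (smooth of relative dimension `N`, affine since `Y₀` is affine
and `X` separated), Zariski-locally `V × 𝔸ᴺ → V` (`isZariskiLocallyAffineProduct_proj`), with `(π₀^σ)^*`
bijective because `X^σ` is smooth projective (`bijective_complexBetti_map_of_isZariskiLocallyAffineProduct`).
[cite: Jouanolou1973, Lemme 1.5] -/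
theorem nonempty_jouanolouChart (σ : ℂ ≃+* ℂ) (k : ℕ) {n : ℕ} {X : SchemeOver ℂ}
    (hX : IsSmoothProjective n X) : Nonempty (JouanolouChart σ k X) := by
  obtain ⟨N, ι, hι⟩ := hX.isProjectiveOver
  haveI := hX.smoothOfRelativeDimension
  haveI : IsProper X.hom := IsSmoothProjective.isProper_holds hX
  haveI : SmoothOfRelativeDimension (n + N) (jouanolouTorsor N ι).hom :=
    JouanolouTorsor.smoothOfRelativeDimension_hom' N ι n
  -- `π₀ = incl ≫ pr₁` is smooth of relative dimension `N`
  haveI : SmoothOfRelativeDimension N (JouanolouTorsor.proj N ι).left := by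
    haveI := smoothOfRelativeDimension_isStableUnderBaseChange (n := N)
    haveI : SmoothOfRelativeDimension N
        (CartesianMonoidalCategory.fst X (dualProjectiveSpace N ℂ)).left :=
      MorphismProperty.pullback_fst (P := @SmoothOfRelativeDimension N) X.hom (dualProjectiveSpace N ℂ).hom
        (JouanolouTorsor.smoothOfRelativeDimension_dualProjectiveSpace_hom N)
    have h := smoothOfRelativeDimension_comp 0 N (jouanolouOpen N ι).ι
      (CartesianMonoidalCategory.fst X (dualProjectiveSpace N ℂ)).left
    rw [Nat.zero_add] at h
    exact h
  haveI : IsAffineHom (JouanolouTorsor.proj N ι).left :=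
    isAffineHom_left_of_isAffine_of_isSeparated (JouanolouTorsor.proj N ι)
  have hXσ : IsSmoothProjective n (conjugateVariety σ X) := IsSmoothProjective.conjugateVariety_holds σ hX
  haveI := ComplexPoints.compactSpace_of_isSmoothProjective hXσ
  haveI := ComplexPoints.t2Space_of_isSmoothProjective hXσ
  exact ⟨{ r := N, m₀ := n + N, Y₀ := jouanolouTorsor N ι, π₀ := JouanolouTorsor.proj N ι,
           isZariskiLocallyAffineProduct := isZariskiLocallyAffineProduct_proj ι,
           bijective := bijective_complexBetti_map_of_isZariskiLocallyAffineProduct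
             ((isZariskiLocallyAffineProduct_proj ι).conjHom σ) k }⟩

/-- A chosen Jouanolou chart of a smooth projective `X` (choice). [cite: Jouanolou1973, Lemme 1.5] -/
def jouanolouChart (σ : ℂ ≃+* ℂ) (k : ℕ) {X : SchemeOver ℂ} (hX : ∃ n, IsSmoothProjective n X) :
    JouanolouChart σ k X :=
  (nonempty_jouanolouChart σ k hX.choose_spec).some

namespace JouanolouChart

variable {X : SchemeOver ℂ} (J : JouanolouChart σ k X)

/-- The inverse of the bijection `(π₀^σ)^* : Hᵏ(X^σ(ℂ)) → Hᵏ(Y₀^σ(ℂ))`, as an equivalence.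
[cite: Jouanolou1973, Lemme 1.5] -/
def conjPullbackEquiv : complexBetti (conjugateVariety σ X) k ≃ complexBetti (conjugateVariety σ J.Y₀) k :=
  Equiv.ofBijective _ J.bijective

/-- The equivalence IS `(π₀^σ)^*` (definitional). [cite: Jouanolou1973, Lemme 1.5] -/
@[simp]
theorem conjPullbackEquiv_apply (d : complexBetti (conjugateVariety σ X) k) :
    J.conjPullbackEquiv d = complexBetti.map (conjHom σ J.π₀) k d := rfl

/-- **Transport of an affine conjugation along the chart**: `Θ_X := ((π₀^σ)^*)⁻¹ ∘ θ_{Y₀} ∘ π₀^*`.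
[cite: CharlesSchnell2014Notes, §11.2.2 (11.2.3)] -/
def transport (θ : ∀ Y : SchemeOver ℂ, complexBetti Y k → complexBetti (conjugateVariety σ Y) k)
    (c : complexBetti X k) : complexBetti (conjugateVariety σ X) k :=
  J.conjPullbackEquiv.symm (θ J.Y₀ (complexBetti.map J.π₀ k c))

/-- Defining identity of the transport: `(π₀^σ)^* (Θ_X c) = θ_{Y₀} (π₀^* c)`.
[cite: CharlesSchnell2014Notes, §11.2.2 (11.2.3)] -/
theorem map_transport (θ : ∀ Y : SchemeOver ℂ, complexBetti Y k → complexBetti (conjugateVariety σ Y) k)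
    (c : complexBetti X k) :
    complexBetti.map (conjHom σ J.π₀) k (J.transport θ c) = θ J.Y₀ (complexBetti.map J.π₀ k c) := by
  rw [← conjPullbackEquiv_apply, transport, Equiv.apply_symm_apply]

end JouanolouChart

end Chart

/-! ### §3 The extension `Θ` of an affine conjugation datum and its naturality -/

section Extend

variable {σ : ℂ ≃+* ℂ} {k : ℕ}
  (θ : ∀ Y : SchemeOver ℂ, complexBetti Y k → complexBetti (conjugateVariety σ Y) k)

open Classical in
/-- **The extension `Θ`** of a conjugation datum `θ` from smooth affine to all `ℂ`-schemes: on a smooth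
projective `X`, transport along the chosen Jouanolou chart, `Θ_X := ((π₀^σ)^*)⁻¹ ∘ θ_{Y₀} ∘ π₀^*`;
otherwise `Θ_X := θ_X`. [cite: CharlesSchnell2014Notes, §11.2.2 (11.2.3)] -/
def extendConj (X : SchemeOver ℂ) : complexBetti X k → complexBetti (conjugateVariety σ X) k :=
  if hX : ∃ n, IsSmoothProjective n X then (jouanolouChart σ k hX).transport θ else θ X

/-- On a smooth projective `X`, `Θ_X` is the transport along the chosen Jouanolou chart (unfolding).
[cite: CharlesSchnell2014Notes, §11.2.2 (11.2.3)] -/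
theorem extendConj_of_isSmoothProjective {X : SchemeOver ℂ} (hX : ∃ n, IsSmoothProjective n X) :
    extendConj θ X = (jouanolouChart σ k hX).transport θ := by
  rw [extendConj, dif_pos hX]

/-- Off smooth projective `X`, `Θ_X = θ_X` (unfolding). [cite: CharlesSchnell2014Notes, §11.2.2 (11.2.3)] -/
theorem extendConj_of_not {X : SchemeOver ℂ} (hX : ¬ ∃ n, IsSmoothProjective n X) :
    extendConj θ X = θ X := by
  rw [extendConj, dif_neg hX]

variable (hlin : ∀ (Y : SchemeOver ℂ) (a : ℂ) (c₁ c₂ : complexBetti Y k),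
    θ Y (a • c₁ + c₂) = σ a • θ Y c₁ + θ Y c₂)
  (hnat : ∀ ⦃Y Y' : SchemeOver ℂ⦄ (g : Y' ⟶ Y) (m m' : ℕ) [IsAffine Y.left]
    [SmoothOfRelativeDimension m Y.hom] [IsAffine Y'.left] [SmoothOfRelativeDimension m' Y'.hom]
    (c : complexBetti Y k), θ Y' (complexBetti.map g k c) = complexBetti.map (conjHom σ g) k (θ Y c))

include hlin in
/-- `Θ` is `σ`-semilinear (transport of the semilinearity of `θ` along the linear maps `π₀^*`,
`(π₀^σ)^*`). [cite: CharlesSchnell2014Notes, §11.2.2 (11.2.3)] -/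
theorem extendConj_smul_add (X : SchemeOver ℂ) (a : ℂ) (c₁ c₂ : complexBetti X k) :
    extendConj θ X (a • c₁ + c₂) = σ a • extendConj θ X c₁ + extendConj θ X c₂ := by
  by_cases hX : ∃ n, IsSmoothProjective n X
  · rw [extendConj_of_isSmoothProjective θ hX]
    set J := jouanolouChart σ k hX
    apply J.bijective.1
    rw [J.map_transport, map_add, map_smul, map_add, map_smul, J.map_transport, J.map_transport, hlin]
  · rw [extendConj_of_not θ hX]
    exact hlin X a c₁ c₂

include hnat in
/-- **Key lemma: naturality of `Θ` for morphisms from smooth affine schemes into charted schemes.** For a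
Jouanolou chart `J` of `X`, a smooth affine `Y'`, `h : Y' ⟶ X` and `c ∈ Hᵏ(X(ℂ); ℂ)`:
`θ_{Y'} (h^* c) = (h^σ)^* (Θ_X c)` with `Θ_X = J.transport θ`. Proof through `W := Y' ×_X Y₀` (smooth
affine; `p : W ⟶ Y'` an affine-space bundle, so `(p^σ)^*` is injective):
`(p^σ)^* θ_{Y'} h^* c = θ_W (h p)^* c = θ_W (π₀ q)^* c = (q^σ)^* θ_{Y₀} π₀^* c = (q^σ)^* (π₀^σ)^* Θ_X c
= (p^σ)^* (h^σ)^* Θ_X c`. [cite: CharlesSchnell2014Notes, §11.2.2 (11.2.2)–(11.2.3)] [cite: Jouanolou1973, Lemme 1.5] -/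
theorem theta_map_eq_map_transport {X : SchemeOver ℂ} (J : JouanolouChart σ k X)
    (m' : ℕ) {Y' : SchemeOver ℂ} [IsAffine Y'.left] [SmoothOfRelativeDimension m' Y'.hom]
    (h : Y' ⟶ X) (c : complexBetti X k) :
    θ Y' (complexBetti.map h k c) = complexBetti.map (conjHom σ h) k (J.transport θ c) := by
  -- the fibre product `W := Y' ×_X Y₀`, smooth affine, with projections `p`, `q`
  haveI : SmoothOfRelativeDimension (J.r + m') (fibreProd h J.π₀).hom :=
    fibreProd.smoothOfRelativeDimension_hom h J.π₀ J.r m'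
  -- `(p^σ)^*` is injective: `p^σ` is an affine-space bundle over the paracompact Hausdorff `Y'^σ(ℂ)`
  have hpσ : IsZariskiLocallyAffineProduct (conjHom σ (fibreProd.fst h J.π₀)) J.r :=
    (J.isZariskiLocallyAffineProduct.fibreProd_fst h).conjHom σ
  haveI : T2Space (ComplexPoints (conjugateVariety σ Y')) := AffineCoordinates.t2Space _
  haveI : ParacompactSpace (ComplexPoints (conjugateVariety σ Y')) :=
    paracompactSpace_complexPoints_of_smooth_affine m' _
  apply (bijective_complexBetti_map_of_isZariskiLocallyAffineProduct hpσ k).1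
  -- chase the element
  have e₁ : complexBetti.map (fibreProd.fst h J.π₀) k (complexBetti.map h k c) =
      complexBetti.map (fibreProd.snd h J.π₀) k (complexBetti.map J.π₀ k c) := by
    change (complexBetti.map h k ≫ complexBetti.map (fibreProd.fst h J.π₀) k) c =
      (complexBetti.map J.π₀ k ≫ complexBetti.map (fibreProd.snd h J.π₀) k) c
    rw [← complexBetti.map_comp, ← complexBetti.map_comp, fibreProd.condition]
  have e₂ : ∀ d : complexBetti (conjugateVariety σ X) k,
      complexBetti.map (conjHom σ (fibreProd.snd h J.π₀)) k (complexBetti.map (conjHom σ J.π₀) k d) =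
        complexBetti.map (conjHom σ (fibreProd.fst h J.π₀)) k (complexBetti.map (conjHom σ h) k d) := by
    intro d
    change (complexBetti.map (conjHom σ J.π₀) k ≫ complexBetti.map (conjHom σ (fibreProd.snd h J.π₀)) k) d =
      (complexBetti.map (conjHom σ h) k ≫ complexBetti.map (conjHom σ (fibreProd.fst h J.π₀)) k) d
    rw [← complexBetti.map_comp, ← complexBetti.map_comp, ← conjHom_comp, ← conjHom_comp,
      fibreProd.condition]
  rw [← hnat (fibreProd.fst h J.π₀) m' (J.r + m') (complexBetti.map h k c), e₁,
    hnat (fibreProd.snd h J.π₀) J.m₀ (J.r + m') (complexBetti.map J.π₀ k c), ← J.map_transport θ c, e₂]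

include hnat in
/-- **Naturality of `Θ` (clause (ii) with smooth affine source).** For `X` smooth projective, `Y'`
smooth affine, `h : Y' ⟶ X`: `θ_{Y'} (h^* c) = (h^σ)^* (Θ_X c)`.
[cite: CharlesSchnell2014Notes, §11.2.2 (11.2.2)–(11.2.3)] -/
theorem theta_map_eq_map_extendConj {X : SchemeOver ℂ} (hX : ∃ n, IsSmoothProjective n X)
    (m' : ℕ) {Y' : SchemeOver ℂ} [IsAffine Y'.left] [SmoothOfRelativeDimension m' Y'.hom]
    (h : Y' ⟶ X) (c : complexBetti X k) :
    θ Y' (complexBetti.map h k c) = complexBetti.map (conjHom σ h) k (extendConj θ X c) := by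
  rw [extendConj_of_isSmoothProjective θ hX]
  exact theta_map_eq_map_transport θ hnat _ m' h c

include hnat in
/-- **`Θ = θ` on smooth affine schemes** (also when they happen to be smooth projective: the key lemma
with `h = 𝟙`). [cite: CharlesSchnell2014Notes, §11.2.2 (11.2.3)] -/
theorem extendConj_eq_of_affine (m : ℕ) (Y : SchemeOver ℂ) [IsAffine Y.left]
    [SmoothOfRelativeDimension m Y.hom] (c : complexBetti Y k) : extendConj θ Y c = θ Y c := by
  by_cases hY : ∃ n, IsSmoothProjective n Y
  · have e := theta_map_eq_map_extendConj θ hnat hY m (𝟙 Y) c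
    rw [complexBetti.map_id, conjHom_id, complexBetti.map_id] at e
    exact e.symm
  · rw [extendConj_of_not θ hY]

include hnat in
/-- **Naturality of `Θ` (clause (ii) in full).** For `X` smooth projective and `g : Y ⟶ X` from a `Y`
that is smooth projective OR smooth affine: `Θ_Y (g^* c) = (g^σ)^* (Θ_X c)`. (Projective `Y`: apply the
key lemma to `π₁ ≫ g` for `Y`'s own chart `π₁ : Y₁ ⟶ Y` and cancel the bijection `(π₁^σ)^*`.)
[cite: CharlesSchnell2014Notes, §11.2.2 (11.2.2)–(11.2.3)] -/
theorem extendConj_map {n : ℕ} {X : SchemeOver ℂ} (hX : IsSmoothProjective n X) {Y : SchemeOver ℂ}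
    (g : Y ⟶ X)
    (hY : (∃ m, IsSmoothProjective m Y) ∨
      (IsAffine Y.left ∧ ∃ m, SmoothOfRelativeDimension m Y.hom))
    (c : complexBetti X k) :
    extendConj θ Y (complexBetti.map g k c) = complexBetti.map (conjHom σ g) k (extendConj θ X c) := by
  by_cases hYp : ∃ m, IsSmoothProjective m Y
  · -- projective source: go through `Y`'s own chart
    rw [extendConj_of_isSmoothProjective θ hYp]
    set J₁ := jouanolouChart σ k hYp
    apply J₁.bijective.1
    rw [J₁.map_transport]
    have e := theta_map_eq_map_extendConj θ hnat ⟨n, hX⟩ J₁.m₀ (J₁.π₀ ≫ g) c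
    rw [complexBetti.map_comp, conjHom_comp, complexBetti.map_comp] at e
    exact e
  · -- affine, non-projective source: `Θ_Y = θ_Y`
    obtain ⟨hYa, m, hYs⟩ := hY.resolve_left hYp
    haveI := hYa; haveI := hYs
    rw [extendConj_of_not θ hYp]
    exact theta_map_eq_map_extendConj θ hnat ⟨n, hX⟩ m g c

end Extend

/-! ### §4 The reduction theorem -/

/-- **`chartConjugation_canonical` from an affine conjugation datum.** Suppose that for every
`σ ∈ Aut ℂ` and degree `k` there are maps `θ_Y : Hᵏ(Y(ℂ); ℂ) → Hᵏ(Y^σ(ℂ); ℂ)` (`Y` a `ℂ`-scheme) which are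
(a) `σ`-semilinear, (b) natural for `ℂ`-morphisms between SMOOTH AFFINE `ℂ`-schemes —
`θ_{Y'} (g^* c) = (g^σ)^* (θ_Y c)` — and (c) computed by charts on smooth affine `Y` verbatim as in clause
(iii) of `chartConjugation_canonical` (for every model space, every natural complex de Rham family
rationally normalised in degree `k`, every pair of analytic models and every algebraic form expression
with closed realisations). Then `chartConjugation_canonical` holds: the witness is the extension `Θ` of
`θ` along Jouanolou charts (`extendConj`), clause (i) = `extendConj_smul_add`, (ii) = `extendConj_map`,
(iii) = (c) transported by `extendConj_eq_of_affine`. In print, (a)–(c) on smooth affine varieties are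
the `σ`-linear isomorphism of algebraic de Rham complexes `α ↦ α^σ` (Charles–Schnell (11.2.2)–(11.2.3))
read through Grothendieck's comparison `H•(Γ(Y, Ω•)) ⥲ H•(Y^an; ℂ)` (Grothendieck 1966, Thm. 1′), and
the passage to projective `X` is Jouanolou's device (Lemme 1.5), as here.
[cite: CharlesSchnell2014Notes, §11.2.2 (11.2.2)–(11.2.3)] [cite: Jouanolou1973, Lemme 1.5]
[cite: Grothendieck1966, Thm. 1'] -/
theorem chartConjugation_canonical_of_affine
    (H : ∀ (σ : ℂ ≃+* ℂ) (k : ℕ),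
      ∃ θ : ∀ Y : SchemeOver ℂ, complexBetti Y k → complexBetti (conjugateVariety σ Y) k,
        (∀ (Y : SchemeOver ℂ) (a : ℂ) (c₁ c₂ : complexBetti Y k),
            θ Y (a • c₁ + c₂) = σ a • θ Y c₁ + θ Y c₂) ∧
        (∀ ⦃Y Y' : SchemeOver ℂ⦄ (g : Y' ⟶ Y) (m m' : ℕ) [_root_.AlgebraicGeometry.IsAffine Y.left]
            [_root_.AlgebraicGeometry.SmoothOfRelativeDimension m Y.hom]
            [_root_.AlgebraicGeometry.IsAffine Y'.left]
            [_root_.AlgebraicGeometry.SmoothOfRelativeDimension m' Y'.hom] (c : complexBetti Y k),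
            θ Y' (complexBetti.map g k c) = complexBetti.map (conjHom σ g) k (θ Y c)) ∧
        (∀ (E : Type) [NormedAddCommGroup E] [NormedSpace ℂ E] [FiniteDimensional ℂ E]
          (e : ComplexDeRhamIsoFamily E), e.IsNatural → IsRationalDeRhamFamily e k →
          ∀ (m : ℕ) (Y : SchemeOver ℂ) [_root_.AlgebraicGeometry.IsAffine Y.left]
            [_root_.AlgebraicGeometry.SmoothOfRelativeDimension m Y.hom]
            (A : AnalyticModel E m Y) (A' : AnalyticModel E m (conjugateVariety σ Y))
            (ξ : AlgFormExpr Y k) (hξ : ξ.realize A ∈ cclosedSmoothForms E A.carrier k)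
            (hξ' : (ξ.conj σ).realize A' ∈ cclosedSmoothForms E A'.carrier k) (c : complexBetti Y k),
            A.pullback k c = e A.carrier k (complexDeRhamCohomology.mk E A.carrier k ⟨_, hξ⟩) →
            A'.pullback k (θ Y c) =
              e A'.carrier k (complexDeRhamCohomology.mk E A'.carrier k ⟨_, hξ'⟩))) :
    chartConjugation_canonical := by
  intro σ k
  obtain ⟨θ, hlin, hnat, hchart⟩ := H σ k
  refine ⟨extendConj θ, extendConj_smul_add θ hlin, fun n X hX Y g hY c ↦ extendConj_map θ hnat hX g hY c,
    fun E _ _ _ e he hr m Y _ _ A A' ξ hξ hξ' c hc ↦ ?_⟩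
  rw [extendConj_eq_of_affine θ hnat m Y c]
  exact hchart E e he hr m Y A A' ξ hξ hξ' c hc

end HodgeTheory

end Literature.AlgebraicGeometry.HodgeTheory

end
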